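import Summits.BirchSwinnertonDyer.Rank1Residual.ManinAdditive.CMTwinStevensMinimal
import Literature.NumberTheory.EllipticCurves.ShimuraSubgroupHeckeCongruence
import HarnessLib

/-!
# CM TWIN STEVENS-MINIMALITY, addendum 44.K: THE PARTNER LAW — E-es-139₂/₃, E-es-140₂/₃^loc, COR 44.K, the root edge
(cell `bsd-f2-manin`, planner `-es` g30, MEMO-es §44.J–§44.K; T-es-47 FINAL part 3/3)

TYPER NOTE (typer g19, T-es-47 FINAL scope §3–§9).  SOURCE = HOME/es/g30/Sketch-es-g30.lean FINAL sha16 7254ca973fbc1207 (761 l.; es: farm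
rc 0 · 0 err · 0 warn · 0 s∗rry, axioms standard; BC7 19/19 CLEAN incl. Probe4 6fbe3d53422ff454) §9 (l. 581–757) VERBATIM except the namespace
(`…ManinAdditive.KatoCurve.CMTwinMinimal`, continued from parts 1–2 `CMTwinStevensMinimal.lean` p716468 / `CMTwinStevensMinimalNetCount.lean`
p716671, whose §3–§8 text is byte-identical between 1665c8a0c824a273 and 7254ca973fbc1207) and this note; §9's extra import
`Literature…ShimuraSubgroupHeckeCongruence` (tree theorem `gamma1LatticeEqOfTwoTracelessPrimes_holds`, Ling–Oesterlé / Yoo) is carried here.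
`@[conjecture]` on the cell laws **E-es-139₂/₃ `CMRootPartnerGammaOneLawTwoLocal/ThreeLocal`** (root partner Γ₁-law ⟺ `c₁(K)` prime to p;
TRUE at 32, 64 / 27 by Stevens (7.1) = tree fact `Stevens1989_thm_7_1_gamma1Lattice_conductor_le_200`, p717062) and **E-es-140₂/₃^loc
`CMPartnerPeriodLatticeLawTwoLocal/ThreeLocal`** (partner period-lattice law, NO exclusions; BC5 649/649 resp. all `j = 0` classes
N < 5·10⁵, CM-REROOT-v1 54fa4276c4abf38c); SUPPORTS `CMTwinPrimitiveVectorTwo/Three` (classical index-2 / index-3 twin inclusion; dischargeable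
from `CMOptimalCoordinates`) are plain `def … : Prop`, nothing asserted.  PROVED: SQUEEZE (B′) `not_dvd_maninConstant_of_saturated_mem_of_witness`,
COR 44.K `not_two_dvd_maninConstant_on_cmClass_two_partner` / `not_three_dvd_maninConstant_on_cmClass_three_partner` (C2 / C3 on EVERY CM class,
32a/64a/27a included, from E-es-140^loc ∧ E-es-133⁺ ∧ the primitive-vector support ∧ Faltings), ROOT EDGES `partnerPeriodLaw_on_root_of_gammaOne` /
`partnerPeriodLawThree_on_root_of_gammaOne` (E-es-139 ⟹ E-es-140^loc at roots with two traceless primes).  44.J (es): the LOCATION conjunct of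
E-es-137 is retracted as load-bearing — E-es-137/136 stay in the tree as typed (bodies immutable); the live residual is E-es-140^loc.  Refuter
verdict R-es-68 pending at landing time.  Imports = part 1 + one Literature module — ROUTE-INDEPENDENT.  PARTITION 0 · beyond-print theorem: no ·
bears_on stmt-BirchSwinnertonDyer-22967 / 22968 (CM slices) · BSD is not proved by this; C2, C3 OPEN.
-/

set_option autoImplicit false

noncomputable section

namespace Summit.BirchSwinnertonDyer.Rank1Residual.ManinAdditive.KatoCurve.CMTwinMinimal

open scoped MatrixGroups ModularForm
open CongruenceSubgroup WeierstrassCurve Literature.NumberTheory.EllipticCurves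
  Literature.NumberTheory.EllipticCurves.ModularForms
  Summit.BirchSwinnertonDyer.Rank1Residual.ManinAdditive.KatoCurve.CMOptimal

/-! ## §9 (addendum 44.K) THE PARTNER LAW — no exclusions, no location: SQUEEZE (B′) with a witness vector,
E-es-139₂ (root partner `Γ₁`-law ⟺ `c₁(K_a)` odd), E-es-140₂^loc (partner period-lattice law, ALL classes),
COR 44.K (C2 on every `ℚ(i)`-CM class from E-es-140₂^loc ∧ E-es-133⁺₂ ∧ a primitive-vector support), and the
root edge E-es-139₂ ⟹ E-es-140₂^loc at every root with two traceless primes (Ling–Oesterlé–Yoo `Λ₁ = Λ₀`, tree). -/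
section PartnerLaw

variable {W : WeierstrassCurve ℚ} {N : ℕ} [NeZero N]

/-- **SQUEEZE (B′) — witness form.**  `X₀(N)`-datum `D` of `W` with the lattice clause `Λ_W = c·Λ_f`; every period
`{∞, γ∞}_f` has a prime-to-`p` multiple in a submodule `M` (NOT required to lie inside `Λ_W`); and ONE vector
`z ∈ Λ_W` with `s z ∉ p M` for every `s` prime to `p`.  Then `p ∤ c`.  Proof: `z = c w`, `s w ∈ M`; if `c = p c′`
then `s z = p · (c′ s w) ∈ p M`. -/
theorem not_dvd_maninConstant_of_saturated_mem_of_witness (D : ModularParametrizationData W N)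
    (hD : ∀ z ∈ D.L.lattice, ∃ w ∈ periodLattice D.f, z = D.c * w)
    {p : ℤ} (hp : Prime p) (M : Submodule ℤ ℂ)
    (hM : ∀ γ : Gamma0 N, ∃ s : ℤ, ¬ p ∣ s ∧ (s : ℂ) * cuspSymbol D.f γ ∈ M)
    (hz : ∃ z ∈ D.L.lattice, ∀ s : ℤ, ¬ p ∣ s → ∀ m ∈ M, (s : ℂ) * z ≠ (p : ℂ) * m) :
    ¬ p ∣ D.maninConstant := by
  have hΛ : periodLattice D.f ≤ primeSaturation p hp M := by
    unfold periodLattice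
    exact (AddSubgroup.closure_le _).mpr (by rintro _ ⟨γ, rfl⟩; exact hM γ)
  obtain ⟨z, hzL, hzM⟩ := hz
  obtain ⟨w, hw, hw'⟩ := hD z hzL
  obtain ⟨s, hs, hsw⟩ := mem_primeSaturation.mp (hΛ hw)
  change ¬ p ∣ D.c
  rintro ⟨c', hc'⟩
  refine hzM s hs (c' • ((s : ℂ) * w)) (M.smul_mem c' hsw) ?_
  rw [hw', hc', zsmul_eq_mul]; push_cast; ring

/-- **E-es-139₂ `CMRootPartnerGammaOneLawTwoLocal` — THE ROOT PARTNER `Γ₁`-LAW (candidate, one parameter).**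
For a root `V = E_a` (`a` squarefree, ALL `a` incl. `±1`), its newform `f` and the `j = 1728` PARTNER `V′ = E_{−4a}`
(`c₄(V′) = −4 c₄(V)`, `c₆(V′) = 0`) with Néron pair `L′`: every `X₁`-period of `f` has an ODD multiple in `Λ(V′)` — the
BIG lattice (`Λ(V) ⊆ Λ(V′)`, index 2).  ⟺ `c₁(K_a)` odd (whichever of `E_a, E_{−4a}` is `X₁(N)`-optimal); WEAKER than
E-es-136₂; TRUE at `a = ±1` (Stevens (7.1)); BC5: `c₀ = 1` (Cremona) ⟹ `c₁ = ±1` (`c₁ ∣ c₀`, tree) at all root classes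
`N < 5·10⁵` — no exclusion.  For `a ∉ {±1, ±2}` it is EQUIVALENT to C2 on `K_a` (`c₀ = ±c₁`, two traceless primes, tree). -/
@[conjecture]
def CMRootPartnerGammaOneLawTwoLocal : Prop :=
  ∀ (V V' : WeierstrassCurve ℚ) [V.IsElliptic] [V.IsGloballyMinimal] [V'.IsElliptic] [V'.IsGloballyMinimal]
    {N : ℕ} [NeZero N] (f : CuspForm (Gamma0 N) 2) (L' : PeriodPair),
    (∃ a : ℤ, Squarefree a ∧ V.c₄ = -48 * (a : ℚ) ∧ V.c₆ = 0) →
    IsNewformOf V f → WeierstrassCurve.IsIsogenous V V' → V'.c₄ = -4 * V.c₄ → V'.c₆ = 0 →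
    IsNeronLatticeOf (V'.baseChange ℂ) L' →
    ∀ z ∈ periodLatticeGamma1 f, ∃ s : ℤ, ¬ (2 : ℤ) ∣ s ∧ (s : ℂ) * z ∈ L'.lattice

/-- **E-es-140₂^loc `CMPartnerPeriodLatticeLawTwoLocal` — THE PARTNER PERIOD-LATTICE LAW (candidate; NO exclusions).**
For every twist-reduced `j = 1728` twin `V` (the `c₄`-clause), its newform `f` and its `j = 1728` partner `V′`
(`c₄(V′) = −4c₄(V)`, `c₆(V′) = 0`, Néron pair `L′`): every `Γ₀`-period of `f` has an odd multiple in `Λ(V′)`.  BC5: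
649/649 classes `N < 5·10⁵` (647 with `E₀ = V, c₀ = 1`: `Λ₀ = Λ(V) ⊆ Λ(V′)`; 32a, 64a with `E₀ = V′, c₀ = 1`: `Λ₀ = Λ(V′)`). -/
@[conjecture]
def CMPartnerPeriodLatticeLawTwoLocal : Prop :=
  ∀ (V V' : WeierstrassCurve ℚ) [V.IsElliptic] [V.IsGloballyMinimal] [V'.IsElliptic] [V'.IsGloballyMinimal]
    {N : ℕ} [NeZero N] (f : CuspForm (Gamma0 N) 2) (L' : PeriodPair),
    V.j = 1728 → IsNewformOf V f →
    (∀ (W' : WeierstrassCurve ℚ) [W'.IsElliptic] [W'.IsGloballyMinimal],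
        W'.j = 1728 → WeierstrassCurve.IsIsogenous V W' → (W'.c₄ = V.c₄ ∨ W'.c₄ = -4 * V.c₄)) →
    WeierstrassCurve.IsIsogenous V V' → V'.c₄ = -4 * V.c₄ → V'.c₆ = 0 →
    IsNeronLatticeOf (V'.baseChange ℂ) L' →
    ∀ γ : Gamma0 N, ∃ s : ℤ, ¬ (2 : ℤ) ∣ s ∧ (s : ℂ) * cuspSymbol f γ ∈ L'.lattice

/-- SUPPORT `CMTwinPrimitiveVectorTwo` (classical: `[Λ(V′) : Λ(V)] = 2`, so `Λ(V) ⊄ 2Λ(V′) ⊗ ℤ₍₂₎`; from the explicit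
`j = 1728` Néron coordinates).  One vector `z ∈ Λ(V)` with `s z ∉ 2Λ(V′)` for all odd `s`. -/
def CMTwinPrimitiveVectorTwo : Prop :=
  ∀ (V V' : WeierstrassCurve ℚ) [V.IsElliptic] [V.IsGloballyMinimal] [V'.IsElliptic] [V'.IsGloballyMinimal]
    (LV L' : PeriodPair),
    V.j = 1728 → WeierstrassCurve.IsIsogenous V V' → V'.c₄ = -4 * V.c₄ → V'.c₆ = 0 →
    IsNeronLatticeOf (V.baseChange ℂ) LV → IsNeronLatticeOf (V'.baseChange ℂ) L' →
    ∃ z ∈ LV.lattice, ∀ s : ℤ, ¬ (2 : ℤ) ∣ s → ∀ m ∈ L'.lattice, (s : ℂ) * z ≠ 2 * m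

/-- **COROLLARY 44.K (C2 on EVERY `ℚ(i)`-CM class — 32a and 64a included — from the partner law).**
E-es-140₂^loc ∧ E-es-133⁺₂ ∧ `CMTwinPrimitiveVectorTwo` (∧ Faltings) ⟹ `2² ∣ N → 2 ∤ c(D)` for every optimal datum
`D` (lattice clause) of every globally minimal `W` isogenous to a twist-reduced `j = 1728` twin `V` with partner `V′`. -/
theorem not_two_dvd_maninConstant_on_cmClass_two_partner
    (h140 : CMPartnerPeriodLatticeLawTwoLocal) (hmin : CMTwinStevensMinimalTwo) (hprim : CMTwinPrimitiveVectorTwo)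
    (hL : LFunction_eq_of_isIsogenous)
    (W : WeierstrassCurve ℚ) [W.IsElliptic] [W.IsGloballyMinimal] {N : ℕ} [NeZero N]
    (D : ModularParametrizationData W N)
    (hD : ∀ z ∈ D.L.lattice, ∃ w ∈ periodLattice D.f, z = D.c * w)
    (V V' : WeierstrassCurve ℚ) [V.IsElliptic] [V.IsGloballyMinimal] [V'.IsElliptic] [V'.IsGloballyMinimal]
    (LV L' : PeriodPair) (hjV : V.j = 1728) (hiso : WeierstrassCurve.IsIsogenous V W)
    (hiso' : WeierstrassCurve.IsIsogenous V V') (hc₄ : V'.c₄ = -4 * V.c₄) (hc₆ : V'.c₆ = 0)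
    (hLV : IsNeronLatticeOf (V.baseChange ℂ) LV) (hL' : IsNeronLatticeOf (V'.baseChange ℂ) L')
    (hred : ∀ (W' : WeierstrassCurve ℚ) [W'.IsElliptic] [W'.IsGloballyMinimal],
        W'.j = 1728 → WeierstrassCurve.IsIsogenous V W' → (W'.c₄ = V.c₄ ∨ W'.c₄ = -4 * V.c₄)) :
    2 ^ 2 ∣ N → ¬ (2 : ℤ) ∣ D.maninConstant := fun _ => by
  obtain ⟨z, hz, hzM⟩ := hprim V V' LV L' hjV hiso' hc₄ hc₆ hLV hL'
  refine not_dvd_maninConstant_of_saturated_mem_of_witness D hD Int.prime_two L'.lattice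
    (h140 V V' D.f L' hjV (isNewformOf_of_isIsogenous hL D.isNewformOf hiso) hred hiso' hc₄ hc₆ hL')
    ⟨z, hmin V W LV D.L hjV hiso hLV D.isNeronLattice hred hz, fun s hs m hm => ?_⟩
  exact_mod_cast hzM s hs m hm

/-- **ROOT EDGE: E-es-139₂ ⟹ E-es-140₂^loc at every root class whose level has two traceless primes** (`p² ∣ N`,
`q² ∣ N`, `p ≠ q` — every root `a ∉ {±1, ±2}`: `p = 2`, `q ∣ a` odd), because then `Λ₁(f) = Λ₀(f)`
(Atkin–Lehner `a_p = a_q = 0` + Ling–Oesterlé–Yoo, tree theorem `gamma1LatticeEqOfTwoTracelessPrimes_holds`). -/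
theorem partnerPeriodLaw_on_root_of_gammaOne (h139 : CMRootPartnerGammaOneLawTwoLocal)
    (V V' : WeierstrassCurve ℚ) [V.IsElliptic] [V.IsGloballyMinimal] [V'.IsElliptic] [V'.IsGloballyMinimal]
    (f : CuspForm (Gamma0 N) 2) (L' : PeriodPair)
    (hroot : ∃ a : ℤ, Squarefree a ∧ V.c₄ = -48 * (a : ℚ) ∧ V.c₆ = 0)
    (hf : IsNewformOf V f) (hiso' : WeierstrassCurve.IsIsogenous V V') (hc₄ : V'.c₄ = -4 * V.c₄)
    (hc₆ : V'.c₆ = 0) (hL' : IsNeronLatticeOf (V'.baseChange ℂ) L')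
    {p q : ℕ} (hp : p.Prime) (hq : q.Prime) (hne : p ≠ q) (hp2 : p ^ 2 ∣ N) (hq2 : q ^ 2 ∣ N) :
    ∀ γ : Gamma0 N, ∃ s : ℤ, ¬ (2 : ℤ) ∣ s ∧ (s : ℂ) * cuspSymbol f γ ∈ L'.lattice := by
  intro γ
  have heq := ModularForms.gamma1LatticeEqOfTwoTracelessPrimes_holds N f hf.1 p q hp hq hne
    ((dvd_pow_self p two_ne_zero).trans hp2) ((dvd_pow_self q two_ne_zero).trans hq2)
    (hf.1.cuspCoeff_eq_zero_of_sq_dvd hp hp2) (hf.1.cuspCoeff_eq_zero_of_sq_dvd hq hq2)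
  have hmem : cuspSymbol f γ ∈ periodLatticeGamma1 f := by
    rw [heq]; unfold periodLattice; exact AddSubgroup.subset_closure ⟨γ, rfl⟩
  exact h139 V V' f L' hroot hf hiso' hc₄ hc₆ hL' _ hmem

/-- **E-es-139₃ `CMRootPartnerGammaOneLawThreeLocal`** (`j = 0` roots `E_B`, partner `V′ = E_{−27B}`: `c₄(V′) = 0`,
`c₆(V′) = −27 c₆(V)`; ⟺ `3 ∤ c₁(K_B)`; TRUE at 27a by Stevens (7.1); BC5 all root classes `N < 5·10⁵` via `c₁ ∣ c₀ = 1`). -/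
@[conjecture]
def CMRootPartnerGammaOneLawThreeLocal : Prop :=
  ∀ (V V' : WeierstrassCurve ℚ) [V.IsElliptic] [V.IsGloballyMinimal] [V'.IsElliptic] [V'.IsGloballyMinimal]
    {N : ℕ} [NeZero N] (f : CuspForm (Gamma0 N) 2) (L' : PeriodPair),
    (∃ B : ℚ, B ≠ 0 ∧ V.c₄ = 0 ∧ V.c₆ = -864 * B ∧ padicValRat 3 B ≤ 2 ∧
        ∀ p : ℕ, p.Prime → 5 ≤ p → padicValRat p B ≤ 2) →
    IsNewformOf V f → WeierstrassCurve.IsIsogenous V V' → V'.c₄ = 0 → V'.c₆ = -27 * V.c₆ →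
    IsNeronLatticeOf (V'.baseChange ℂ) L' →
    ∀ z ∈ periodLatticeGamma1 f, ∃ s : ℤ, ¬ (3 : ℤ) ∣ s ∧ (s : ℂ) * z ∈ L'.lattice

/-- **E-es-140₃^loc `CMPartnerPeriodLatticeLawThreeLocal`** (NO exclusions; BC5 1848/1848: `E₀ ∈ {V, V′}`, `c₀ = 1`). -/
@[conjecture]
def CMPartnerPeriodLatticeLawThreeLocal : Prop :=
  ∀ (V V' : WeierstrassCurve ℚ) [V.IsElliptic] [V.IsGloballyMinimal] [V'.IsElliptic] [V'.IsGloballyMinimal]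
    {N : ℕ} [NeZero N] (f : CuspForm (Gamma0 N) 2) (L' : PeriodPair),
    V.j = 0 → IsNewformOf V f →
    (∀ (W' : WeierstrassCurve ℚ) [W'.IsElliptic] [W'.IsGloballyMinimal],
        W'.j = 0 → WeierstrassCurve.IsIsogenous V W' → (W'.c₆ = V.c₆ ∨ W'.c₆ = -27 * V.c₆)) →
    WeierstrassCurve.IsIsogenous V V' → V'.c₄ = 0 → V'.c₆ = -27 * V.c₆ →
    IsNeronLatticeOf (V'.baseChange ℂ) L' →
    ∀ γ : Gamma0 N, ∃ s : ℤ, ¬ (3 : ℤ) ∣ s ∧ (s : ℂ) * cuspSymbol f γ ∈ L'.lattice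

/-- SUPPORT `CMTwinPrimitiveVectorThree` (classical: `[Λ(V′) : Λ(V)] = 3`). -/
def CMTwinPrimitiveVectorThree : Prop :=
  ∀ (V V' : WeierstrassCurve ℚ) [V.IsElliptic] [V.IsGloballyMinimal] [V'.IsElliptic] [V'.IsGloballyMinimal]
    (LV L' : PeriodPair),
    V.j = 0 → WeierstrassCurve.IsIsogenous V V' → V'.c₄ = 0 → V'.c₆ = -27 * V.c₆ →
    IsNeronLatticeOf (V.baseChange ℂ) LV → IsNeronLatticeOf (V'.baseChange ℂ) L' →
    ∃ z ∈ LV.lattice, ∀ s : ℤ, ¬ (3 : ℤ) ∣ s → ∀ m ∈ L'.lattice, (s : ℂ) * z ≠ 3 * m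

/-- **COROLLARY 44.K₃ (C3 on EVERY `ℚ(√−3)`-CM class — 27a included — from the partner law).** -/
theorem not_three_dvd_maninConstant_on_cmClass_three_partner
    (h140 : CMPartnerPeriodLatticeLawThreeLocal) (hmin : CMTwinStevensMinimalThree)
    (hprim : CMTwinPrimitiveVectorThree) (hL : LFunction_eq_of_isIsogenous)
    (W : WeierstrassCurve ℚ) [W.IsElliptic] [W.IsGloballyMinimal] {N : ℕ} [NeZero N]
    (D : ModularParametrizationData W N)
    (hD : ∀ z ∈ D.L.lattice, ∃ w ∈ periodLattice D.f, z = D.c * w)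
    (V V' : WeierstrassCurve ℚ) [V.IsElliptic] [V.IsGloballyMinimal] [V'.IsElliptic] [V'.IsGloballyMinimal]
    (LV L' : PeriodPair) (hjV : V.j = 0) (hiso : WeierstrassCurve.IsIsogenous V W)
    (hiso' : WeierstrassCurve.IsIsogenous V V') (hc₄ : V'.c₄ = 0) (hc₆ : V'.c₆ = -27 * V.c₆)
    (hLV : IsNeronLatticeOf (V.baseChange ℂ) LV) (hL' : IsNeronLatticeOf (V'.baseChange ℂ) L')
    (hred : ∀ (W' : WeierstrassCurve ℚ) [W'.IsElliptic] [W'.IsGloballyMinimal],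
        W'.j = 0 → WeierstrassCurve.IsIsogenous V W' → (W'.c₆ = V.c₆ ∨ W'.c₆ = -27 * V.c₆)) :
    3 ^ 2 ∣ N → ¬ (3 : ℤ) ∣ D.maninConstant := fun _ => by
  obtain ⟨z, hz, hzM⟩ := hprim V V' LV L' hjV hiso' hc₄ hc₆ hLV hL'
  refine not_dvd_maninConstant_of_saturated_mem_of_witness D hD Int.prime_three L'.lattice
    (h140 V V' D.f L' hjV (isNewformOf_of_isIsogenous hL D.isNewformOf hiso) hred hiso' hc₄ hc₆ hL')
    ⟨z, hmin V W LV D.L hjV hiso hLV D.isNeronLattice hred hz, fun s hs m hm => ?_⟩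
  exact_mod_cast hzM s hs m hm

/-- **ROOT EDGE at `p = 3`: E-es-139₃ ⟹ E-es-140₃^loc at every `j = 0` root whose level has two traceless primes**
(every root except 27a). -/
theorem partnerPeriodLawThree_on_root_of_gammaOne (h139 : CMRootPartnerGammaOneLawThreeLocal)
    (V V' : WeierstrassCurve ℚ) [V.IsElliptic] [V.IsGloballyMinimal] [V'.IsElliptic] [V'.IsGloballyMinimal]
    (f : CuspForm (Gamma0 N) 2) (L' : PeriodPair)
    (hroot : ∃ B : ℚ, B ≠ 0 ∧ V.c₄ = 0 ∧ V.c₆ = -864 * B ∧ padicValRat 3 B ≤ 2 ∧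
        ∀ p : ℕ, p.Prime → 5 ≤ p → padicValRat p B ≤ 2)
    (hf : IsNewformOf V f) (hiso' : WeierstrassCurve.IsIsogenous V V') (hc₄ : V'.c₄ = 0)
    (hc₆ : V'.c₆ = -27 * V.c₆) (hL' : IsNeronLatticeOf (V'.baseChange ℂ) L')
    {p q : ℕ} (hp : p.Prime) (hq : q.Prime) (hne : p ≠ q) (hp2 : p ^ 2 ∣ N) (hq2 : q ^ 2 ∣ N) :
    ∀ γ : Gamma0 N, ∃ s : ℤ, ¬ (3 : ℤ) ∣ s ∧ (s : ℂ) * cuspSymbol f γ ∈ L'.lattice := by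
  intro γ
  have heq := ModularForms.gamma1LatticeEqOfTwoTracelessPrimes_holds N f hf.1 p q hp hq hne
    ((dvd_pow_self p two_ne_zero).trans hp2) ((dvd_pow_self q two_ne_zero).trans hq2)
    (hf.1.cuspCoeff_eq_zero_of_sq_dvd hp hp2) (hf.1.cuspCoeff_eq_zero_of_sq_dvd hq hq2)
  have hmem : cuspSymbol f γ ∈ periodLatticeGamma1 f := by
    rw [heq]; unfold periodLattice; exact AddSubgroup.subset_closure ⟨γ, rfl⟩
  exact h139 V V' f L' hroot hf hiso' hc₄ hc₆ hL' _ hmem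

end PartnerLaw

end Summit.BirchSwinnertonDyer.Rank1Residual.ManinAdditive.KatoCurve.CMTwinMinimal

end
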